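import Summits.ResolutionOfSingularities.ResolutionOfSingularities.Theorems.FrobeniusLadderFInjectiveMacaulayficationPencilIntegral
import Mathlib.Algebra.MvPolynomial.Division
import HarnessLib

/-!
# TASK 4b, primality of the local-model pencil chart: `M⁺·W − B⁺` is PRIME in `k[W, y₁..y_n]` when `B` is regular modulo `M` (the `G`-free twin of ✓p692944 `pencilChart_isPrime`,
# base = affine space; discharges the p- and tag-free hypothesis `Prime Φ` of ✓p696297 `PencilExitTagW`)
# (crux `FInjectiveMacaulayfication` stmt-ResolutionOfSingularities-15315, chain w45a; RULING R23.2 (2) TASK 4b; seat res-L1-w45a-stub-1 g14)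

[OURS · L1 W4.5a] Support file (`--supports stmt-ResolutionOfSingularities-15315 --as helper`); theorems only; unconditional; any field. Nothing of the crux is proved.
AI-written (AI review is weaker than expert review).
* `finSuccEquiv_pencilPhi`, `pencilPhi_ne_zero`, ★ `prime_pencilPhiAffine (M B : k[y]) (hM : M ≠ 0) (hreg : ∀ t, B·t ∈ (M) → t ∈ (M)) : Prime (M⁺·X 0 − B⁺)` — ✓p692717 §1
  `isPrime_span_C_mul_X_sub_C` over the domain `k[y₁..y_n]`, pulled back along `MvPolynomial.finSuccEquiv`. Letter: pencil variable `X 0`, base letters renamed along `Fin.succ`.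
* §2 (v2) `monomial_dvd_of_dvd_mul` (a monomial is regular modulo anything its variables miss; Mathlib `X_prime`), `not_X_dvd_binomial`, ★★ `prime_pencilPhiW` — `Φ_W` prime from
  `M₁ ⊥ M₂`, `r ⊥ s`, `r ≠ s` alone.
[folklore]
-/

set_option linter.dupNamespace false

noncomputable section

open MvPolynomial

namespace Summit.ResolutionOfSingularities.ResolutionOfSingularities.Theorems.FInjectiveMacaulayfication.PencilPhiPrime

open Summit.ResolutionOfSingularities.ResolutionOfSingularities.Theorems.FInjectiveMacaulayfication

variable (k : Type) [Field k] {n : ℕ}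

/-- `finSuccEquiv (M⁺·X 0 − B⁺) = C M · X − C B`. [plumbing] -/
theorem finSuccEquiv_pencilPhi (M B : MvPolynomial (Fin n) k) :
    finSuccEquiv k n (rename Fin.succ M * X 0 - rename Fin.succ B) = Polynomial.C M * Polynomial.X - Polynomial.C B := by
  rw [map_sub, map_mul, PencilIntegral.finSuccEquiv_rename_succ, PencilIntegral.finSuccEquiv_rename_succ, finSuccEquiv_X_zero]

/-- `M⁺·X 0 − B⁺ ≠ 0` for `M ≠ 0`. [plumbing] -/
theorem pencilPhi_ne_zero (M B : MvPolynomial (Fin n) k) (hM : M ≠ 0) :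
    (rename Fin.succ M * X 0 - rename Fin.succ B : MvPolynomial (Fin (n + 1)) k) ≠ 0 := by
  intro h
  have h1 := congrArg (fun q => Polynomial.coeff (finSuccEquiv k n q) 1) h
  simp only [finSuccEquiv_pencilPhi, map_zero, Polynomial.coeff_zero, Polynomial.coeff_sub, Polynomial.coeff_C_mul_X, if_true,
    Polynomial.coeff_C_succ, sub_zero] at h1
  exact hM h1

/-- ★ **THE LOCAL-MODEL PENCIL CHART EQUATION `M⁺·X 0 − B⁺` IS PRIME** when `M ≠ 0` and `B` is regular modulo `M` (`B·t ∈ (M) ⇒ t ∈ (M)` in `k[y₁..y_n]`). [folklore; OURS as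
the `G`-free twin of ✓p692944] -/
theorem prime_pencilPhiAffine (M B : MvPolynomial (Fin n) k) (hM : M ≠ 0)
    (hreg : ∀ t : MvPolynomial (Fin n) k, B * t ∈ Ideal.span {M} → t ∈ Ideal.span {M}) :
    Prime (rename Fin.succ M * X 0 - rename Fin.succ B : MvPolynomial (Fin (n + 1)) k) := by
  have hprime := PencilIntegral.isPrime_span_C_mul_X_sub_C M B hM hreg
  set e := finSuccEquiv k n with he
  have hΦ := finSuccEquiv_pencilPhi k M B
  have hcomap : (Ideal.span {Polynomial.C M * Polynomial.X - Polynomial.C B}).comap (e : MvPolynomial (Fin (n + 1)) k →+* Polynomial (MvPolynomial (Fin n) k)) =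
      Ideal.span {rename Fin.succ M * X 0 - rename Fin.succ B} := by
    ext f
    rw [Ideal.mem_comap, RingHom.coe_coe, Ideal.mem_span_singleton', Ideal.mem_span_singleton']
    constructor
    · rintro ⟨u, hu⟩
      refine ⟨e.symm u, e.injective ?_⟩
      rw [map_mul, e.apply_symm_apply, he, hΦ]; exact hu
    · rintro ⟨u, rfl⟩
      exact ⟨e u, by rw [map_mul, he, hΦ]⟩
  rw [← Ideal.span_singleton_prime (pencilPhi_ne_zero k M B hM), ← hcomap]
  exact Ideal.comap_isPrime _ _

/-! ## §2 (v2) Regularity of `y^{M₂}(y^r − y^s)` modulo `y^{M₁}` from the exponent data, and the primality of `Φ_W` unconditionally in the tag letter -/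

/-- **A monomial `y^M` is regular modulo any `B` missed by all its variables**: if `X_i ∤ B` for every `i` with `M i ≠ 0`, then `y^M ∣ B·t ⇒ y^M ∣ t` (the variables are prime,
Mathlib `MvPolynomial.X_prime`). [folklore] -/
theorem monomial_dvd_of_dvd_mul (B : MvPolynomial (Fin n) k) :
    ∀ (M : Fin n →₀ ℕ), (∀ i, M i ≠ 0 → ¬ (X i : MvPolynomial (Fin n) k) ∣ B) → ∀ t : MvPolynomial (Fin n) k, monomial M (1 : k) ∣ B * t → monomial M (1 : k) ∣ t := by
  classical
  suffices h : ∀ (N : ℕ) (M : Fin n →₀ ℕ), M.sum (fun _ e => e) = N → (∀ i, M i ≠ 0 → ¬ (X i : MvPolynomial (Fin n) k) ∣ B) →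
      ∀ t : MvPolynomial (Fin n) k, monomial M (1 : k) ∣ B * t → monomial M (1 : k) ∣ t from fun M => h _ M rfl
  intro N
  induction N with
  | zero =>
    intro M hM _ t _
    have : M = 0 := by
      ext i
      have := Finset.sum_eq_zero_iff.1 (by rw [Finsupp.sum] at hM; exact hM) i
      by_cases hi : i ∈ M.support
      · exact this hi
      · exact Finsupp.notMem_support_iff.1 hi
    rw [this, monomial_zero', C_1]; exact one_dvd t
  | succ N ih =>
    intro M hM hB t ht
    have hM0 : M ≠ 0 := by rintro rfl; simp at hM
    obtain ⟨i, hi⟩ := Finsupp.ne_iff.1 hM0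
    rw [Finsupp.zero_apply] at hi
    set M' := M - Finsupp.single i 1 with hM'
    have hMM' : M = M' + Finsupp.single i 1 := by
      rw [hM', tsub_add_cancel_of_le]; exact Finsupp.single_le_iff.2 (Nat.one_le_iff_ne_zero.2 hi)
    have hmon : monomial M (1 : k) = monomial M' (1 : k) * X i := by
      rw [hMM', X, monomial_mul, mul_one]
    have hM'sum : M'.sum (fun _ e => e) = N := by
      have h : M.sum (fun _ e => e) = (M' + Finsupp.single i 1).sum (fun _ e => e) := by rw [← hMM']
      rw [Finsupp.sum_add_index' (fun _ => rfl) (fun _ _ _ => rfl), Finsupp.sum_single_index rfl, hM] at h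
      omega
    have hB' : ∀ j, M' j ≠ 0 → ¬ (X j : MvPolynomial (Fin n) k) ∣ B := fun j hj => hB j (by
      rw [hMM', Finsupp.add_apply]; omega)
    -- peel one `X i`
    have hXi : (X i : MvPolynomial (Fin n) k) ∣ B * t := (Dvd.intro_left _ hmon.symm).trans ht |> fun h => by
      obtain ⟨q, hq⟩ := ht; exact ⟨monomial M' 1 * q, by rw [hq, hmon]; ring⟩
    rcases X_dvd_mul_iff.1 hXi with h | ⟨t', rfl⟩
    · exact absurd h (hB i hi)
    · have h2 : monomial M' (1 : k) ∣ B * t' := by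
        obtain ⟨q, hq⟩ := ht
        refine ⟨q, mul_left_cancel₀ (X_ne_zero i : (X i : MvPolynomial (Fin n) k) ≠ 0) ?_⟩
        calc X i * (B * t') = B * (X i * t') := by ring
          _ = monomial M 1 * q := hq
          _ = X i * (monomial M' 1 * q) := by rw [hmon]; ring
      obtain ⟨q', hq'⟩ := ih M' hM'sum hB' t' h2
      exact ⟨q', by rw [hq', hmon]; ring⟩

/-- `X_i ∤ y^r − y^s` when `r ≠ s` and `X_i` misses one of the two monomials (`r i = 0 ∨ s i = 0`). [folklore] -/
theorem not_X_dvd_binomial (r s : Fin n →₀ ℕ) (hne : r ≠ s) (i : Fin n) (hi : r i = 0 ∨ s i = 0) :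
    ¬ (X i : MvPolynomial (Fin n) k) ∣ monomial r (1 : k) - monomial s 1 := by
  classical
  rintro ⟨q, hq⟩
  -- kill the letter `i`: the left side survives (at least one monomial misses `X_i`), the right side dies
  have h := congrArg (aeval fun j : Fin n => if j = i then (0 : MvPolynomial (Fin n) k) else X j) hq
  rw [map_mul, aeval_X, if_pos rfl, zero_mul, map_sub] at h
  have hk : ∀ m : Fin n →₀ ℕ, aeval (fun j : Fin n => if j = i then (0 : MvPolynomial (Fin n) k) else X j) (monomial m (1 : k)) = if m i = 0 then monomial m 1 else 0 := by
    intro m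
    rw [aeval_monomial, map_one, one_mul]
    split_ifs with hm
    · rw [monomial_eq, C_1, one_mul, Finsupp.prod, Finsupp.prod]
      refine Finset.prod_congr rfl fun j hj => ?_
      have hj0 : j ≠ i := by rintro rfl; exact (Finsupp.mem_support_iff.1 hj) hm
      rw [if_neg hj0]
    · rw [Finsupp.prod, Finset.prod_eq_zero (i := i) (Finsupp.mem_support_iff.2 hm)]
      rw [if_pos rfl, zero_pow hm]
  rw [hk, hk] at h
  rcases hi with hri | hsi
  · rw [if_pos hri] at h
    split_ifs at h with hsi
    · exact hne (by
        have := sub_eq_zero.1 h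
        rw [monomial_eq_monomial_iff] at this
        rcases this with ⟨h1, -⟩ | ⟨h1, -⟩
        · exact h1
        · exact absurd h1 one_ne_zero)
    · rw [sub_zero, monomial_eq_zero] at h; exact one_ne_zero h
  · rw [if_pos hsi] at h
    split_ifs at h with hri
    · exact hne (by
        have := sub_eq_zero.1 h
        rw [monomial_eq_monomial_iff] at this
        rcases this with ⟨h1, -⟩ | ⟨h1, -⟩
        · exact h1
        · exact absurd h1 one_ne_zero)
    · rw [zero_sub, neg_eq_zero, monomial_eq_zero] at h; exact one_ne_zero h

/-- ★★ **`Φ_W = (y^{M₁})⁺·X 0 − (y^{M₂}(y^r − y^s))⁺` IS PRIME from the exponent data alone**: `M₁ ⊥ M₂`, `r ⊥ s` (disjoint supports) and `r ≠ s`. (The tag letter of ✓p696297 /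
`PencilExitTagCode1`; discharges their hypothesis `hΦp` once and for all.) [folklore; OURS] -/
theorem prime_pencilPhiW (M₁ M₂ r s : Fin n →₀ ℕ) (hdisj : ∀ i, M₁ i = 0 ∨ M₂ i = 0) (hrs : ∀ i, r i = 0 ∨ s i = 0) (hne : r ≠ s) :
    Prime (rename Fin.succ (monomial M₁ (1 : k)) * X 0 - rename Fin.succ (monomial M₂ (1 : k) * (monomial r 1 - monomial s 1)) : MvPolynomial (Fin (n + 1)) k) := by
  classical
  refine prime_pencilPhiAffine k _ _ (by rw [Ne, monomial_eq_zero]; exact one_ne_zero) fun t ht => ?_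
  rw [Ideal.mem_span_singleton] at ht ⊢
  refine monomial_dvd_of_dvd_mul k _ M₁ (fun i hi hdvd => ?_) t ht
  rcases X_dvd_mul_iff.1 hdvd with h | h
  · have hM₂ : M₂ i = 0 := (hdisj i).resolve_left hi
    rw [X, monomial_dvd_monomial] at h
    rcases h.1 with h0 | hle
    · exact one_ne_zero h0
    · have := hle i; rw [Finsupp.single_eq_same, hM₂] at this; exact Nat.not_succ_le_zero 0 this
  · exact not_X_dvd_binomial k r s hne i (hrs i) h

end Summit.ResolutionOfSingularities.ResolutionOfSingularities.Theorems.FInjectiveMacaulayfication.PencilPhiPrime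

end
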